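import Mathlib
import Literature.Analysis.FluidPDE.HardSphereCollisionRecord
import Literature.MathematicalPhysics.KineticTheory.HardSphereEuler
import Literature.MathematicalPhysics.KineticTheory.HardSphereEulerProofs
import Literature.MathematicalPhysics.KineticTheory.CollisionTubePullbackFlight
import Literature.MathematicalPhysics.KineticTheory.HardSphereUntaggedSubsystem
import Summits.AtomisticToContinuum.HydrodynamicLimit.Theorems.OneFlightGossipEngineOneFlightLayeredChaosFirstCollision
import HarnessLib

/-!
# `OneFlightGossipEngine.OneFlightLayeredChaos` — ghost-environment identification of the first-flight event, I: glue
(crux stmt-AtomisticToContinuum-14535, line `Sketch`, reduction R2 of the first rung `stub_firstFlight_velInput`;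
registered stub `firstFlightEvent_subset_ghost`; stub worker of lead cycle c3, wave 3, 2026-08-17).

Deterministic lemmas on good orbits. With `Φ` the `(N+1)`-sphere flow, `Ψ` a hard-sphere flow of `m` spheres and
`emb : Fin m ↪ Fin (N+1)` an enumeration of the labels other than the pair `{i, j}` ("ghost environment": the other
particles evolved WITHOUT `i` and `j`):
* `flow_comp_emb_eq` — the sub-configuration `Φ_t z ∘ emb` follows the flow `Ψ` as long as no contact of the big
  orbit joins a label of `range emb` to a label outside it (the subsystem lemma of `HardSphereUntaggedSubsystem` for a
  general embedding instead of `Fin.natAdd`; local forward uniqueness `eqOn_Icc_of_hardSphereEvents`);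
* elementary real analysis of an ENTRANCE TIME `sInf {t > 0 | g t ≤ c}` of a continuous `g` (attained when positive,
  `g = c` there and `g > c` before) and continuity of the minimal-image distance of two free flights;
* `firstFlightEvent_subset_ghost` (→, registered) — on the first-flight event of the pair (first collision of `i` at
  `t₀ > 0`, with `j`, `j` fresh) the entrance time `inf {t > 0 | ‖sepVec (x_i + t v_i) (x_j + t v_j)‖ ≤ ε}` of the two
  free flights is `t₀` and every ghost particle stays at distance `> ε` from the two free flights during `(0, t₀]`.
The converse inclusion `firstFlight_of_ghost` (first deviation time + hard core + binary collisions; no gluing of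
trajectories is needed), the named entrance time `freeEntranceTime` and the ghost event are in the companion file
`…FirstFlightGhostInput`. Theorems only; no definition.
-/

open scoped BigOperators ENNReal Topology
open MeasureTheory Set Filter
open Literature.Analysis.FluidPDE Literature.MathematicalPhysics.KineticTheory
open Summit.AtomisticToContinuum.HydrodynamicLimit.Theorems

namespace Summit.AtomisticToContinuum.HydrodynamicLimit.Theorems.OLC

noncomputable section

/-! ## Restriction of a configuration along an embedding of labels -/

section Emb

variable {d : Type*} [Fintype d] {X : Type*} {G : Geometry d X} {ε : ℝ} {m n : ℕ} (emb : Fin m ↪ Fin n)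

/-- Restriction along an embedding commutes with free flight. [folklore] -/
theorem freeFlight_comp_emb (t : ℝ) (z : Config n d X) :
    (freeFlight G t z ∘ emb : Config m d X) = freeFlight G t (z ∘ emb) := rfl

/-- A configuration of the hard-sphere domain restricts to one. [folklore] -/
theorem comp_emb_mem_hardSphereDomain {z : Config n d X} (hz : z ∈ hardSphereDomain G n ε) :
    (z ∘ emb : Config m d X) ∈ hardSphereDomain G m ε := by
  rw [mem_hardSphereDomain] at hz ⊢
  intro a b hab
  exact hz (emb a) (emb b) fun h => hab (emb.injective h)

/-- Inside the hard-sphere domain, the restriction is a contact configuration of `(a, b)` iff the configuration is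
one of `(emb a, emb b)`. [folklore] -/
theorem comp_emb_mem_contactSet_iff {z : Config n d X} (hz : z ∈ hardSphereDomain G n ε) (a b : Fin m) :
    (z ∘ emb : Config m d X) ∈ contactSet G m ε a b ↔ z ∈ contactSet G n ε (emb a) (emb b) := by
  simp only [mem_contactSet, hz, comp_emb_mem_hardSphereDomain emb hz, true_and, Function.comp_apply]

/-- Restriction along an embedding commutes with the collision of an embedded pair. [folklore] -/
theorem collidePair_comp_emb {a b : Fin m} (hab : a ≠ b) (z : Config n d X) :
    (collidePair G (emb a) (emb b) z ∘ emb : Config m d X) = collidePair G a b (z ∘ emb) := by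
  have hIJ : emb a ≠ emb b := fun h => hab (emb.injective h)
  funext k
  by_cases hkb : k = b
  · subst hkb
    simp only [Function.comp_apply, collidePair_apply_right]
  by_cases hka : k = a
  · subst hka
    simp only [Function.comp_apply, collidePair_apply_left hIJ, collidePair_apply_left hab]
  · have hkI : emb k ≠ emb a := fun h => hka (emb.injective h)
    have hkJ : emb k ≠ emb b := fun h => hkb (emb.injective h)
    simp only [Function.comp_apply, collidePair_apply_of_ne hkI hkJ, collidePair_apply_of_ne hka hkb]

/-- The collision of a pair of labels outside the range does not affect the restriction. [folklore] -/
theorem collidePair_comp_emb_of_not_exists {I J : Fin n} (hI : ¬ ∃ l, emb l = I) (hJ : ¬ ∃ l, emb l = J)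
    (z : Config n d X) : (collidePair G I J z ∘ emb : Config m d X) = z ∘ emb := by
  funext k
  have hkI : emb k ≠ I := fun h => hI ⟨k, h⟩
  have hkJ : emb k ≠ J := fun h => hJ ⟨k, h⟩
  simp only [Function.comp_apply, collidePair_apply_of_ne hkI hkJ]

omit [Fintype d] in
/-- Restriction along an embedding is continuous. [folklore] -/
theorem continuous_comp_emb [TopologicalSpace X] :
    Continuous fun z : Config n d X => (z ∘ emb : Config m d X) :=
  continuous_pi fun _ => continuous_apply _

omit [Fintype d] in
/-- Restriction along an embedding is measurable. [folklore] -/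
theorem measurable_comp_emb [MeasurableSpace X] :
    Measurable fun z : Config n d X => (z ∘ emb : Config m d X) :=
  measurable_pi_lambda _ fun _ => measurable_pi_apply _

/-- **The embedded subsystem follows its own flow as long as it does not touch the other particles.** Let `Ψ`, `Φ`
be hard-sphere flows of `m` and `n` particles (same geometry and diameter), `emb : Fin m ↪ Fin n`, `z` a good datum of
`Φ` whose restriction `z ∘ emb` is good for `Ψ`, and `h` such that every contact of the orbit `Φ_τ z`, `τ ∈ (0, h]`,
joins two labels of `range emb` or two labels outside it. Then `Φ_τ z ∘ emb = Ψ_τ (z ∘ emb)` for `τ ∈ [0, h]` (the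
restriction is free flight between the collision times of the orbit, jumps by the elastic law at contacts of two
embedded labels and is continuous at the other contacts; `eqOn_Icc_of_hardSphereEvents`). The subsystem lemma
`HardSphereFlow.untagged_flow_eq` of `HardSphereUntaggedSubsystem` (CIP 1994 §4.3, App. 4.B: between its collisions with
the others a group of particles moves with its own dynamics) for a general embedding of labels instead of `Fin.natAdd`;
same proof. [folklore] -/
theorem flow_comp_emb_eq [MeasureSpace X] [TopologicalSpace X] [T2Space X]
    (hG : ∀ x : X, Continuous (G.translate x)) (Ψ : HardSphereFlow G ε m) (Φ : HardSphereFlow G ε n)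
    {z : Config n d X} (hz : z ∈ Φ.good) (hzm : (z ∘ emb : Config m d X) ∈ Ψ.good) {h : ℝ}
    (hnc : ∀ τ ∈ Ioc 0 h, ∀ I J : Fin n, I ≠ J → Φ.flow τ z ∈ contactSet G n ε I J →
      ((∃ l, emb l = I) ↔ (∃ l, emb l = J))) :
    ∀ τ ∈ Icc 0 h, (Φ.flow τ z ∘ emb : Config m d X) = Ψ.flow τ (z ∘ emb) := by
  have hγn := Φ.isTrajectory z hz
  have hγm := Ψ.isTrajectory _ hzm
  set γ : ℝ → Config m d X := fun τ => (Φ.flow τ z ∘ emb : Config m d X) with hγdef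
  set γ' : ℝ → Config m d X := fun τ => Ψ.flow τ (z ∘ emb) with hγ'def
  set E : Set ℝ := collisionTimes G ε fun τ => Φ.flow τ z with hEdef
  set E' : Set ℝ := collisionTimes G ε γ' with hE'def
  have huc : ∀ τ (a b : Fin m), γ τ ∈ contactSet G m ε a b →
      Φ.flow τ z ∈ contactSet G n ε (emb a) (emb b) :=
    fun τ a b hc => (comp_emb_mem_contactSet_iff emb (hγn.mem τ) a b).1 hc
  have key : EqOn γ γ' (Icc 0 h) := by
    refine eqOn_Icc_of_hardSphereEvents (G := G) (ε := ε) hG (E := E) (E' := E')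
      (hγn.locFinite 0 h) (hγm.locFinite 0 h) ?_ ?_ ?_ ?_ ?_ ?_ ?_ ?_ ?_ ?_ ?_
    · intro a
      exact hγn.pos_continuous (emb a)
    · intro a
      exact hγm.pos_continuous a
    · intro s t _ hst _ hfree
      show (Φ.flow t z ∘ emb : Config m d X) = _
      rw [hγn.free s t hst hfree]
      rfl
    · intro s t _ hst _ hfree
      exact hγm.free s t hst hfree
    · -- contact of two embedded labels: jump of the restriction
      intro τ _ _ a b hab hc
      have hIJ : emb a ≠ emb b := fun h => hab (emb.injective h)
      obtain ⟨-, zl, hzl, -, heq⟩ := hγn.binary τ _ _ hIJ (huc τ a b hc)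
      refine ⟨zl ∘ emb, ?_, ?_⟩
      · exact ((continuous_comp_emb emb).tendsto zl).comp hzl
      · show (Φ.flow τ z ∘ emb : Config m d X) = _
        rw [heq, collidePair_comp_emb emb hab]
    · intro τ _ _ a b hab hc
      obtain ⟨-, zl, hzl, -, heq⟩ := hγm.binary τ a b hab hc
      exact ⟨zl, hzl, heq⟩
    · -- an event of the big orbit which is not a contact of two embedded labels joins two labels outside the
      -- range: the restriction is (left-)continuous there
      intro τ hτ hτE hnot
      obtain ⟨I, J, hIJ, hc⟩ := hτE
      have hIJ' := hnc τ hτ I J hIJ hc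
      by_cases hI : ∃ a, emb a = I
      · obtain ⟨a, rfl⟩ := hI
        obtain ⟨b, rfl⟩ := hIJ'.1 ⟨a, rfl⟩
        have hab : a ≠ b := fun h => hIJ (h ▸ rfl)
        exact absurd ((comp_emb_mem_contactSet_iff emb (hγn.mem τ) a b).2 hc) (hnot a b hab)
      · have hJ : ¬ ∃ b, emb b = J := fun h => hI (hIJ'.2 h)
        obtain ⟨-, zl, hzl, -, heq⟩ := hγn.binary τ _ _ hIJ hc
        have hlim : Tendsto γ (𝓝[<] τ) (𝓝 (zl ∘ emb)) := ((continuous_comp_emb emb).tendsto zl).comp hzl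
        have hval : γ τ = (zl ∘ emb : Config m d X) := by
          show (Φ.flow τ z ∘ emb : Config m d X) = _
          rw [heq, collidePair_comp_emb_of_not_exists emb hI hJ]
        rw [hval]
        exact hlim
    · intro τ _ hτE hnot
      obtain ⟨a, b, hab, hc⟩ := hτE
      exact absurd hc (hnot a b hab)
    · intro τ _ a b hab hc
      have hIJ : emb a ≠ emb b := fun h => hab (emb.injective h)
      exact ⟨_, _, hIJ, huc τ a b hc⟩
    · intro τ _ a b hab hc
      exact ⟨a, b, hab, hc⟩
    · show (Φ.flow 0 z ∘ emb : Config m d X) = Ψ.flow 0 (z ∘ emb)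
      rw [Φ.flow_zero z hz, Ψ.flow_zero _ hzm]
  intro τ hτ
  exact key hτ

end Emb

/-! ## The entrance time of two free flights -/

section Entrance

variable {n : ℕ}

/-- The minimal-image distance of the two free flights is continuous in time. [folklore] -/
theorem continuous_norm_sepVec_freeFlight (z : Config n (Fin 3) T3) (i j : Fin n) :
    Continuous fun t : ℝ => ‖(Torus.geometry (Fin 3)).sepVec (freeFlight (Torus.geometry (Fin 3)) t z i).1
      (freeFlight (Torus.geometry (Fin 3)) t z j).1‖ := by
  have h : ∀ k : Fin n, Continuous fun t : ℝ => (freeFlight (Torus.geometry (Fin 3)) t z k).1 := fun k => by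
    simp only [freeFlight_apply]
    exact (Torus.continuous_geometry_translate _).comp (continuous_id.smul continuous_const)
  simp only [Torus.norm_geometry_sepVec]
  simpa only [Function.comp_def] using Torus.continuous_euclidDist.comp ((h i).prodMk (h j))

/-- For a continuous `g`, if the infimum of `{t > 0 | g t ≤ c}` is positive then it is attained: it is the least
element. [folklore] -/
theorem isLeast_sInf_of_pos {g : ℝ → ℝ} (hg : Continuous g) {c : ℝ} (h : 0 < sInf {t : ℝ | 0 < t ∧ g t ≤ c}) :
    IsLeast {t : ℝ | 0 < t ∧ g t ≤ c} (sInf {t : ℝ | 0 < t ∧ g t ≤ c}) := by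
  set S : Set ℝ := {t : ℝ | 0 < t ∧ g t ≤ c} with hS
  have hne : S.Nonempty := by
    by_contra hne
    rw [Set.not_nonempty_iff_eq_empty] at hne
    rw [hne, Real.sInf_empty] at h
    exact lt_irrefl 0 h
  have hbdd : BddBelow S := ⟨0, fun t ht => ht.1.le⟩
  refine ⟨⟨h, ?_⟩, fun t ht => csInf_le hbdd ht⟩
  have hcl : closure S ⊆ {t | g t ≤ c} := closure_minimal (fun t ht => ht.2) (isClosed_le hg continuous_const)
  exact hcl (csInf_mem_closure hne hbdd)

/-- At the least positive time with `g ≤ c` a continuous `g` equals `c` (it is `> c` just before). [folklore] -/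
theorem eq_of_isLeast_pos {g : ℝ → ℝ} (hg : Continuous g) {c t : ℝ} (h : IsLeast {t : ℝ | 0 < t ∧ g t ≤ c} t) :
    g t = c := by
  refine le_antisymm h.1.2 ?_
  have hlt : ∀ u ∈ Ioo 0 t, c < g u := fun u hu =>
    lt_of_not_ge fun hle => (not_le.2 hu.2) (h.2 ⟨hu.1, hle⟩)
  have htend : Tendsto g (𝓝[<] t) (𝓝 (g t)) := (hg.tendsto t).mono_left nhdsWithin_le_nhds
  have hev : ∀ᶠ u in 𝓝[<] t, c ≤ g u := by
    filter_upwards [Ioo_mem_nhdsLT h.1.1] with u hu using (hlt u hu).le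
  exact ge_of_tendsto htend hev

/-- Before the least positive time with `g ≤ c`, `g > c`. [folklore] -/
theorem lt_of_isLeast_pos {g : ℝ → ℝ} {c t : ℝ} (h : IsLeast {t : ℝ | 0 < t ∧ g t ≤ c} t) {u : ℝ}
    (hu : u ∈ Ioo 0 t) : c < g u :=
  lt_of_not_ge fun hle => (not_le.2 hu.2) (h.2 ⟨hu.1, hle⟩)

end Entrance

/-! ## The two inclusions between the first-flight event and the ghost event -/

section Inclusions

variable {σ : ℝ} {N m : ℕ} (Φ : HardSphereFlow (Torus.geometry (Fin 3)) (hsDiameter σ N) (N + 1))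
  (Ψ : HardSphereFlow (Torus.geometry (Fin 3)) (hsDiameter σ N) m) {i j : Fin (N + 1)} (emb : Fin m ↪ Fin (N + 1))
  {z : Config (N + 1) (Fin 3) T3}

/-- The minimal-image distance is symmetric. [folklore] -/
theorem norm_sepVec_comm (x y : T3) :
    ‖(Torus.geometry (Fin 3)).sepVec x y‖ = ‖(Torus.geometry (Fin 3)).sepVec y x‖ := by
  rw [Torus.norm_geometry_sepVec, Torus.norm_geometry_sepVec, Torus.euclidDist_comm]

/-- On a good orbit, a particle taking part in no collision during `(0, T)` is at its free-flight position at every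
time of `[0, T]`. [folklore] -/
theorem pos_eq_freeFlight_of_forall_not_participates (hz : z ∈ Φ.good) (k : Fin (N + 1)) {T : ℝ} (hT : 0 ≤ T)
    (hk : ∀ u ∈ Ioo 0 T, ¬ Participates (Torus.geometry (Fin 3)) (hsDiameter σ N) (Φ.flow u z) k)
    {t : ℝ} (ht : t ∈ Icc 0 T) :
    (Φ.flow t z k).1 = (freeFlight (Torus.geometry (Fin 3)) t z k).1 := by
  have h := orbit_pos_eq_of_forall_not_participates (Φ := Φ) hz k hT (fun u hu => hk u hu) ht
  simp only [orbit_apply, sub_zero] at h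
  rw [h, Φ.flow_zero z hz, freeFlight_apply, Torus.geometry_translate]

/-- **(→) The first-flight event lies in the ghost event.** On a good orbit whose restriction to the labels other
than `{i, j}` is good for the ghost flow `Ψ`: if the first collision of `i` happens at `t₀ > 0`, with `j`, and `j`
is fresh, then the entrance time of the two free flights is `t₀` and during `(0, t₀]` every ghost particle stays at
distance `> ε` from both free flights (the other particles follow `Ψ` up to `t₀` by `flow_comp_emb_eq` — before `t₀`
no contact involves `i` or `j`, at `t₀` the contact pair is `{i, j}` —, and a contact of a ghost particle with `i` or
`j` during `(0, t₀]` is excluded by the same token). [folklore] -/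
theorem firstFlightEvent_subset_ghost : ∀ {σ : ℝ} {N m : ℕ} (Φ : Literature.Analysis.FluidPDE.HardSphereFlow (Literature.Analysis.FluidPDE.Torus.geometry (Fin 3)) (Literature.MathematicalPhysics.KineticTheory.hsDiameter σ N) (N + 1)) (Ψ : Literature.Analysis.FluidPDE.HardSphereFlow (Literature.Analysis.FluidPDE.Torus.geometry (Fin 3)) (Literature.MathematicalPhysics.KineticTheory.hsDiameter σ N) m) {i j : Fin (N + 1)} (emb : Fin m ↪ Fin (N + 1)), (∀ k : Fin (N + 1), (∃ l, emb l = k) ↔ (k ≠ i ∧ k ≠ j)) → ∀ {z : Literature.Analysis.FluidPDE.Config (N + 1) (Fin 3) Literature.MathematicalPhysics.KineticTheory.T3}, z ∈ Φ.good → (z ∘ emb : Literature.Analysis.FluidPDE.Config m (Fin 3) Literature.MathematicalPhysics.KineticTheory.T3) ∈ Ψ.good → 0 < Φ.nthCollisionTimeOf i 0 z → Φ.nthPartnerOf i 0 z = j → (∀ u ∈ Set.Ioo 0 (Φ.nthCollisionTimeOf i 0 z), ¬ Literature.Analysis.FluidPDE.Participates (Literature.Analysis.FluidPDE.Torus.geometry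 (Fin 3)) (Literature.MathematicalPhysics.KineticTheory.hsDiameter σ N) (Φ.flow u z) j) → sInf {t : ℝ | 0 < t ∧ ‖(Literature.Analysis.FluidPDE.Torus.geometry (Fin 3)).sepVec (Literature.Analysis.FluidPDE.freeFlight (Literature.Analysis.FluidPDE.Torus.geometry (Fin 3)) t z i).1 (Literature.Analysis.FluidPDE.freeFlight (Literature.Analysis.FluidPDE.Torus.geometry (Fin 3)) t z j).1‖ ≤ Literature.MathematicalPhysics.KineticTheory.hsDiameter σ N} = Φ.nthCollisionTimeOf i 0 z ∧ ∀ u ∈ Set.Ioc 0 (Φ.nthCollisionTimeOf i 0 z), ∀ k : Fin m, Literature.MathematicalPhysics.KineticTheory.hsDiameter σ N < ‖(Literature.Analysis.FluidPDE.Torus.geometry (Fin 3)).sepVec (Ψ.flow u (z ∘ emb) k).1 (Literature.Analysis.FluidPDE.freeFlight (Literature.Analysis.FluidPDE.Torus.geometry (Fin 3)) u z i).1‖ ∧ Literature.MathematicalPhysics.KineticTheory.hsDiameter σ N < ‖(Literature.Analysis.FluidPDE.Torus.geometry (Fin 3)).sepVec (Ψ.flow u (z ∘ emb) k).1 (Literature.Analysis.FluidPDE.freeFlight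 (Literature.Analysis.FluidPDE.Torus.geometry (Fin 3)) u z j).1‖ := by
  intro σ N m Φ Ψ i j emb hemb z hz hzm ht hj hfresh
  set t₀ := Φ.nthCollisionTimeOf i 0 z with ht₀def
  have hγ := Φ.isTrajectory z hz
  have hfi : ∀ u ∈ Ioo 0 t₀, ¬ Participates (Torus.geometry (Fin 3)) (hsDiameter σ N) (Φ.flow u z) i :=
    fun u hu => not_participates_of_lt_nthCollisionTimeOf_zero Φ i hz ht hu
  have hpart : Participates (Torus.geometry (Fin 3)) (hsDiameter σ N) (Φ.flow t₀ z) i :=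
    (isLeast_of_nthCollisionTimeOf_zero_pos Φ i hz ht).1.1
  have hcol : Collide (Torus.geometry (Fin 3)) (hsDiameter σ N) (Φ.flow t₀ z) i j := by
    have := collide_partner hpart
    rwa [show partner (Torus.geometry (Fin 3)) (hsDiameter σ N) (Φ.flow t₀ z) i = j from hj] at this
  have hnot : ∀ k : Fin (N + 1), k = i ∨ k = j → ¬ ∃ l, emb l = k := by
    rintro k hk ⟨l, rfl⟩
    rcases hk with h | h
    · exact ((hemb (emb l)).1 ⟨l, rfl⟩).1 h
    · exact ((hemb (emb l)).1 ⟨l, rfl⟩).2 h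
  -- the within-block hypothesis of the subsystem lemma on `(0, t₀]`
  have hnc : ∀ τ ∈ Ioc 0 t₀, ∀ I J : Fin (N + 1), I ≠ J →
      Φ.flow τ z ∈ contactSet (Torus.geometry (Fin 3)) (N + 1) (hsDiameter σ N) I J →
      ((∃ l, emb l = I) ↔ (∃ l, emb l = J)) := by
    intro τ hτ I J hIJ hc
    have hpI : Participates (Torus.geometry (Fin 3)) (hsDiameter σ N) (Φ.flow τ z) I :=
      ⟨J, Or.inl (mem_contactPairs.2 ⟨hIJ, hc⟩)⟩
    have hpJ : Participates (Torus.geometry (Fin 3)) (hsDiameter σ N) (Φ.flow τ z) J :=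
      ⟨I, Or.inr (mem_contactPairs.2 ⟨hIJ, hc⟩)⟩
    rcases hτ.2.lt_or_eq with hlt | heq
    · have hI : I ≠ i ∧ I ≠ j :=
        ⟨fun h => hfi τ ⟨hτ.1, hlt⟩ (h ▸ hpI), fun h => hfresh τ ⟨hτ.1, hlt⟩ (h ▸ hpI)⟩
      have hJ : J ≠ i ∧ J ≠ j :=
        ⟨fun h => hfi τ ⟨hτ.1, hlt⟩ (h ▸ hpJ), fun h => hfresh τ ⟨hτ.1, hlt⟩ (h ▸ hpJ)⟩
      exact iff_of_true ((hemb I).2 hI) ((hemb J).2 hJ)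
    · rw [heq] at hpI hpJ
      have hIij : I = i ∨ I = j := by
        rcases hcol with h1 | h2
        · exact (hγ.participates_iff h1).1 hpI
        · exact ((hγ.participates_iff h2).1 hpI).symm
      have hJij : J = i ∨ J = j := by
        rcases hcol with h1 | h2
        · exact (hγ.participates_iff h1).1 hpJ
        · exact ((hγ.participates_iff h2).1 hpJ).symm
      exact iff_of_false (hnot I hIij) (hnot J hJij)
  have hsub := flow_comp_emb_eq emb Torus.continuous_geometry_translate Ψ Φ hz hzm hnc
  refine ⟨(isLeast_freeFlightEntrance_nthCollisionTimeOf_zero Φ i hz ht hj hfresh).csInf_eq, fun u hu k => ?_⟩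
  have hghost : (Ψ.flow u (z ∘ emb) k).1 = (Φ.flow u z (emb k)).1 := by
    rw [← congrFun (hsub u ⟨hu.1.le, hu.2⟩) k]
    rfl
  have hki : emb k ≠ i := ((hemb (emb k)).1 ⟨k, rfl⟩).1
  have hkj : emb k ≠ j := ((hemb (emb k)).1 ⟨k, rfl⟩).2
  have hdom := hγ.mem u
  rw [hghost, ← pos_eq_freeFlight_of_le Φ i hz ht i hfi hu.1.le hu.2,
    ← pos_eq_freeFlight_of_le Φ i hz ht j hfresh hu.1.le hu.2]
  constructor
  · refine lt_of_le_of_ne (mem_hardSphereDomain.1 hdom _ _ hki) fun heq => ?_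
    have hc : Φ.flow u z ∈ contactSet (Torus.geometry (Fin 3)) (N + 1) (hsDiameter σ N) (emb k) i :=
      mem_contactSet.2 ⟨hdom, heq.symm⟩
    exact ((hemb i).1 ((hnc u hu (emb k) i hki hc).1 ⟨k, rfl⟩)).1 rfl
  · refine lt_of_le_of_ne (mem_hardSphereDomain.1 hdom _ _ hkj) fun heq => ?_
    have hc : Φ.flow u z ∈ contactSet (Torus.geometry (Fin 3)) (N + 1) (hsDiameter σ N) (emb k) j :=
      mem_contactSet.2 ⟨hdom, heq.symm⟩
    exact ((hemb j).1 ((hnc u hu (emb k) j hkj hc).1 ⟨k, rfl⟩)).2 rfl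

end Inclusions

end

end Summit.AtomisticToContinuum.HydrodynamicLimit.Theorems.OLC
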